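import Summits.HubbardSuperconductivity.HubbardSuperconductivity.Theorems.AnisotropyChordTransferFibre3TwoHoleGapCert

/-!
# Route `AnisotropyChord` / H0 rotor rung: HOLE₂ at fixed `L` from an APPROXIMATE (small-denominator) Gram certificate

Companion of `…Fibre3TwoHoleGapCert`.  An exact `LDLᵀ` of `holeMatQ s ĝ t` has numerators of hundreds of digits (376 at `L = 9`);
a rounded Cholesky factor with denominator `10⁶` plus the slack `δ = ĝ − ĝ₀` between the certified constant `ĝ` and the target
`ĝ₀ ≥ ¾ε₁` is just as good and ~100× cheaper to check:
* `holeMatQ_symm`: the matrix is symmetric (bond symmetry `bondW_shift`);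
* `abs_quad_le_rowsum`: `|uᵀEu| ≤ Σ_x (Σ_y |E_xy|)·u_x²` for a symmetric real matrix `E` (AM–GM);
* ★★ `twoHoleGapRealAt_of_approxCert`: if `Σ_y |holeMatQ s (ĝ₀+δ) t x y − Σ_i v_i x v_i y| ≤ δ·siteW s x` for every row `x`
  (a finite rational check, `decide`-able at fixed `L`; `v` = rounded Cholesky columns), then `TwoHoleGapRealAt L ĝ₀ 0 s`;
* then `twoHoleGap_of_ratCerts` (…TwoHoleGapCert) assembles HOLE₂(.75) at that `L` from an orbit cover + the pair facts + `¾ε₁ ≤ ĝ₀`.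
Probe (scratch, this seat): `L = 9`, `s = (1,1)`, `ĝ₀ = 22/125`, `δ = 1/250`, denominator `10⁶`: worst row residual `4.6e−5 ≤ δ`;
the `L = 5` analogue is checked by `decide +kernel` in 22 s (≈ 1 ms per rational operation ⇒ ≈ 10 min per class at `L = 9`).
Prover seat `hubbard-h0-rotor-p1` g24; helper for stmt-HubbardSuperconductivity-19089 (`--supports`).
-/

set_option linter.dupNamespace false
set_option autoImplicit false

noncomputable section

open scoped BigOperators
open Complex

namespace Summit.HubbardSuperconductivity.HubbardSuperconductivity.Theorems.AnisotropyChord.Transfer.Fibre3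

variable (L : ℕ) [NeZero L]

namespace TwoHoleCert

/-! ## Symmetry of the matrix -/

omit [NeZero L] in
/-- one directed bond term, transposed: `[y = x+e]·b(x,e) = [x = y+(−e)]·b(y,−e)`. [folklore] -/
theorem bond_term_symm (s x y e : Tor L) :
    (if y = x + e then bondW L s x e else 0) = (if x = y + -e then bondW L s y (-e) else 0) := by
  by_cases h : y = x + e
  · have h' : x = y + -e := by rw [h]; abel
    rw [if_pos h, if_pos h', ← bondW_shift L s y e]
    congr 1
    rw [h]; abel
  · have h' : ¬ (x = y + -e) := by
      intro hx; apply h; rw [hx]; abel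
    rw [if_neg h, if_neg h']

omit [NeZero L] in
/-- ★ `holeMatQ` is symmetric. [folklore] -/
theorem holeMatQ_symm (s : Tor L) (ghat t : ℚ) (x y : Tor L) :
    holeMatQ L s ghat t x y = holeMatQ L s ghat t y x := by
  unfold holeMatQ
  have d1 : (if x = y then degW L s x / 2 else 0) = (if y = x then degW L s y / 2 else 0) := by
    by_cases h : x = y
    · rw [if_pos h, if_pos h.symm, h]
    · rw [if_neg h, if_neg (Ne.symm h)]
  have d2 : (if x = y then ghat * siteW L s x else 0) = (if y = x then ghat * siteW L s y else 0) := by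
    by_cases h : x = y
    · rw [if_pos h, if_pos h.symm, h]
    · rw [if_neg h, if_neg (Ne.symm h)]
  have b1 := bond_term_symm L s x y (ex L)
  have b2 := bond_term_symm L s x y (-ex L)
  have b3 := bond_term_symm L s x y (ey L)
  have b4 := bond_term_symm L s x y (-ey L)
  rw [neg_neg] at b2 b4
  rw [d1, d2, b1, b2, b3, b4]
  ring

/-! ## A quadratic form with small rows is small -/

/-- ★ for a symmetric real matrix, `|uᵀEu| ≤ Σ_x (Σ_y |E_xy|)·u_x²`. [folklore] -/
theorem abs_quad_le_rowsum (E : Tor L → Tor L → ℝ) (hE : ∀ x y, E x y = E y x) (u : Tor L → ℝ) :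
    |∑ x : Tor L, ∑ y : Tor L, u x * E x y * u y| ≤ ∑ x : Tor L, (∑ y : Tor L, |E x y|) * u x ^ 2 := by
  calc |∑ x : Tor L, ∑ y : Tor L, u x * E x y * u y|
      ≤ ∑ x : Tor L, |∑ y : Tor L, u x * E x y * u y| := Finset.abs_sum_le_sum_abs _ _
    _ ≤ ∑ x : Tor L, ∑ y : Tor L, |u x * E x y * u y| :=
        Finset.sum_le_sum fun x _ => Finset.abs_sum_le_sum_abs _ _
    _ ≤ ∑ x : Tor L, ∑ y : Tor L, (|E x y| * u x ^ 2 / 2 + |E x y| * u y ^ 2 / 2) := by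
        refine Finset.sum_le_sum fun x _ => Finset.sum_le_sum fun y _ => ?_
        rw [abs_mul, abs_mul]
        have h := two_mul_le_add_sq (|u x|) (|u y|)
        have hE0 : 0 ≤ |E x y| := abs_nonneg _
        rw [sq_abs, sq_abs] at h
        nlinarith [abs_nonneg (u x), abs_nonneg (u y)]
    _ = ∑ x : Tor L, (∑ y : Tor L, |E x y|) * u x ^ 2 := by
        rw [show (∑ x : Tor L, ∑ y : Tor L, (|E x y| * u x ^ 2 / 2 + |E x y| * u y ^ 2 / 2))
            = (∑ x : Tor L, ∑ y : Tor L, |E x y| * u x ^ 2 / 2) + ∑ x : Tor L, ∑ y : Tor L, |E x y| * u y ^ 2 / 2 by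
          rw [← Finset.sum_add_distrib]; refine Finset.sum_congr rfl fun x _ => ?_; rw [Finset.sum_add_distrib]]
        rw [Finset.sum_comm (f := fun x y => |E x y| * u y ^ 2 / 2)]
        have : ∀ y : Tor L, ∑ x : Tor L, |E x y| * u y ^ 2 / 2 = ∑ x : Tor L, |E y x| * u y ^ 2 / 2 := by
          intro y; refine Finset.sum_congr rfl fun x _ => ?_; rw [hE x y]
        rw [Finset.sum_congr rfl fun y _ => this y, ← Finset.sum_add_distrib]
        refine Finset.sum_congr rfl fun x _ => ?_
        rw [Finset.sum_mul, ← Finset.sum_add_distrib]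
        refine Finset.sum_congr rfl fun y _ => ?_
        ring

/-! ## The approximate certificate -/

/-- ★★ **an approximate rational Gram certificate proves the pair inequality.**  With `ĝ = ĝ₀ + δ`: if every row of
`E = holeMatQ s ĝ t − Σ_i v_i ⊗ v_i` has `Σ_y |E_xy| ≤ δ·siteW(x)` (so the hole rows vanish exactly), then `TwoHoleGapRealAt L ĝ₀ 0 s`. [folklore] -/
theorem twoHoleGapRealAt_of_approxCert {ι : Type*} [Fintype ι] (s : Tor L) (ghat0 delta t : ℚ)
    (v : ι → Tor L → ℚ)
    (hE : ∀ x : Tor L, ∑ y : Tor L, |holeMatQ L s (ghat0 + delta) t x y - ∑ i, v i x * v i y| ≤ delta * siteW L s x) :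
    TwoHoleGapRealAt L (ghat0 : ℝ) 0 s := by
  intro u hmean
  -- the real objects
  set E : Tor L → Tor L → ℝ := fun x y => ((holeMatQ L s (ghat0 + delta) t x y - ∑ i, v i x * v i y : ℚ) : ℝ) with hEd
  have hEsymm : ∀ x y, E x y = E y x := by
    intro x y; simp only [hEd, holeMatQ_symm L s _ _ x y]
    congr 2
    exact Finset.sum_congr rfl fun i _ => by ring
  have hrow : ∀ x : Tor L, ∑ y : Tor L, |E x y| ≤ (delta : ℝ) * (siteW L s x : ℝ) := by
    intro x
    have h := hE x
    have : (∑ y : Tor L, |E x y|) = ((∑ y : Tor L, |holeMatQ L s (ghat0 + delta) t x y - ∑ i, v i x * v i y| : ℚ) : ℝ) := by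
      simp only [hEd]; push_cast; rfl
    rw [this]; exact_mod_cast h
  -- the form splits as Gram + error
  have hsplit : ∀ x y : Tor L, holeMat L s (ghat0 + delta) t x y = (∑ i, (v i x : ℝ) * (v i y : ℝ)) + E x y := by
    intro x y; simp only [hEd, holeMat]; push_cast; ring
  have hq := holeForm_eq_quad L s (ghat0 + delta) t u
  have hG : 0 ≤ ∑ x : Tor L, ∑ y : Tor L, u x * (∑ i, (v i x : ℝ) * (v i y : ℝ)) * u y :=
    quad_nonneg_of_gram L (fun x y => ∑ i, (v i x : ℝ) * (v i y : ℝ)) (fun _ => (1 : ℝ)) (fun _ => zero_le_one)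
      (fun i x => (v i x : ℝ)) (fun x y => Finset.sum_congr rfl fun i _ => by ring) u
  have hEq : |∑ x : Tor L, ∑ y : Tor L, u x * E x y * u y| ≤ ∑ x : Tor L, (∑ y : Tor L, |E x y|) * u x ^ 2 :=
    abs_quad_le_rowsum L E hEsymm u
  have hEr : ∑ x : Tor L, (∑ y : Tor L, |E x y|) * u x ^ 2 ≤ (delta : ℝ) * ∑ x : Tor L, (siteW L s x : ℝ) * u x ^ 2 := by
    rw [Finset.mul_sum]
    refine Finset.sum_le_sum fun x _ => ?_
    have := hrow x
    have hu : 0 ≤ u x ^ 2 := sq_nonneg _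
    nlinarith
  -- `uᵀMu = uᵀGu + uᵀEu ≥ −δ Σ' u²`
  have hform : holeForm L s (ghat0 + delta) t u
      = (∑ x : Tor L, ∑ y : Tor L, u x * (∑ i, (v i x : ℝ) * (v i y : ℝ)) * u y)
        + ∑ x : Tor L, ∑ y : Tor L, u x * E x y * u y := by
    rw [hq, ← Finset.sum_add_distrib]
    refine Finset.sum_congr rfl fun x _ => ?_
    rw [← Finset.sum_add_distrib]
    refine Finset.sum_congr rfl fun y _ => ?_
    rw [hsplit]; ring
  have hlow : -((delta : ℝ) * ∑ x : Tor L, (siteW L s x : ℝ) * u x ^ 2) ≤ holeForm L s (ghat0 + delta) t u := by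
    rw [hform]
    have := neg_abs_le (∑ x : Tor L, ∑ y : Tor L, u x * E x y * u y)
    linarith
  -- unfold the form on a mean-zero `u` and conclude as in `twoHoleGapRealAt_of_psd`
  unfold holeForm at hlow
  have hm : ∑ x : Tor L, (siteW L s x : ℝ) * u x = ∑ x : Tor L, (if (x = 0 ∨ x = s) then (0 : ℝ) else u x) := by
    refine Finset.sum_congr rfl fun x _ => ?_
    unfold siteW; split_ifs <;> simp
  have hmass : ∑ x : Tor L, (siteW L s x : ℝ) * u x ^ 2 = ∑ x : Tor L, (if (x = 0 ∨ x = s) then (0 : ℝ) else u x ^ 2) := by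
    refine Finset.sum_congr rfl fun x _ => ?_
    unfold siteW; split_ifs <;> simp
  have hbond : ∑ x : Tor L, ((bondW L s x (ex L) : ℝ) * (u x - u (x + ex L)) ^ 2
      + (bondW L s x (-ex L) : ℝ) * (u x - u (x + -ex L)) ^ 2 + (bondW L s x (ey L) : ℝ) * (u x - u (x + ey L)) ^ 2
      + (bondW L s x (-ey L) : ℝ) * (u x - u (x + -ey L)) ^ 2)
      = ∑ x : Tor L, ((nnList L).map (fun e =>
          if (x = 0 ∨ x = s ∨ x + e = 0 ∨ x + e = s) then (0 : ℝ) else (u x - u (x + e)) ^ 2)).sum := by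
    refine Finset.sum_congr rfl fun x _ => ?_
    rw [nnList_map_sum]
    unfold bondW
    split_ifs <;> push_cast <;> ring
  rw [hm, hmean, hmass, hbond] at hlow
  have h0 : (0 : ℝ) ^ 2 = 0 := by norm_num
  rw [h0, mul_zero, add_zero] at hlow
  push_cast at hlow
  linarith

end TwoHoleCert

end Summit.HubbardSuperconductivity.HubbardSuperconductivity.Theorems.AnisotropyChord.Transfer.Fibre3

end
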